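import Mathlib.Data.Real.Basic
import Mathlib.Data.Nat.Choose.Basic
import Literature.Computability.QuantumComplexity.PauliParseval
import Literature.InformationTheory.QuantumCodes.SymplecticCodes
import Literature.InformationTheory.QuantumCodes.QuantumSingletonBound
import HarnessLib

/-!
# Linear-programming, shadow and Singleton bounds for quantum codes (Rains; Calderbank–Rains–Shor–Sloane) — statements

Topic `Literature/InformationTheory/QuantumCodes` (venture QEC, cell `qec`, PARTITION v2 row 06 / D2.6; LADDER-QEC rung
X1 «LP/shadow upper bounds per (n,k) — make "optimal" precise; quantum Singleton»). STATEMENTS FIRST: every published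
theorem below is a `[cite:]` NAMED FACT `def … : Prop` (D-0014), never asserted; the definitions are real, and the
LP data (`krawtchouk4`, the linear systems) are computable where a checker needs them. Column words: definition /
cited fact. Each named fact carries a BARRIER block (technique_class / blocks / because / evasions_known /
scope_caveats / status) so that it doubles as the X1 catalogue entry for the census («no `[[n,k,d]]` beyond this
bound» is what a «record» row must respect).

Two vocabularies, both already in the tree:
* ADDITIVE (stabilizer) codes `[[n,k,d]]` in the binary symplectic language of `SymplecticCodes.lean`
  (`SympVec`, `sympWeight`, `sympDual`, `IsAdditiveCode S k d` = «`S̄` self-orthogonal of dimension `n − k`, no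
  vector of weight `≤ d − 1` in `S̄⊥ ∖ S̄`» — the MONOTONE reading «minimum distance at least `d`», with CRSS's
  `k = 0` convention; `AdditiveCodeExists n k d`). This is Rains's «additive code `C` over `GF(4)` of length `n`,
  self-orthogonal, of dimension `n − r`, `C⊥ − C` of minimum weight `d`» with `r = k`
  [Rains1998Shadow, §V p. 138] and CRSS's `(n, 2^{n−k})` code `C` [CalderbankEtAl1998, Thm. 1–2].
* GENERAL codes `((n,K,d))` [Rains1999Shadow, §1 p. 2361]: «a quantum code `𝒞` is a `K`-dimensional subspace of a
  `2ⁿ`-dimensional Hilbert space; `𝒞` has minimum distance `d` iff `⟨v|U_{d−1}|v⟩ = ⟨w|U_{d−1}|w⟩` for all unit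
  vectors `v, w ∈ 𝒞` and all `(d−1)`-qubit errors … it suffices to restrict one's attention to errors
  `σ_1 ⊗ ⋯ ⊗ σ_n`, `σ_i ∈ {1, σ_x, σ_y, σ_z}`; `wt(E)` = the number of the `σ_i` not equal to the identity». We
  carry `𝒞` by its ORTHOGONAL PROJECTION `P` («Let `P` be the orthogonal projection onto a `((n,K,d))`», Thm. 2
  there), a matrix on the register `ι → Bool` of `Literature.Computability.QuantumComplexity.pauliString`, exactly
  as the tree's Knill–Laflamme file `KnillLaflamme.lean` carries codes, and write the printed condition in the
  equivalent projector form `P E P = c_E P` (for Hermitian `E` and the projection `P` onto `𝒞`, `⟨v|E|v⟩` is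
  constant on unit vectors of `𝒞` iff `P E P ∈ ℂ P`, by polarisation; cf. `KnillLaflammeCondition` with the error
  set `{E : wt E ≤ d−1}` and [KnillLaflamme1997, Thm. 3.2]). So `IsCodeProjection P K d` reads «`P` is the
  orthogonal projection onto an `((|ι|,K,d))`», again in the monotone reading (all facts below are UPPER bounds on
  `d`, for which this reading is the faithful and the stronger one). Rains's convention «a `((n,1,d))` must be
  pure» is NOT built in (for `K = 1` detection is vacuous); the facts that need `K > 1` say so.

Contents. Definitions: `pauliWt`; `DetectsWeightLE`, `IsCodeProjection`, `IsPureToWeight`; `krawtchouk4`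
(`P_j(x,n) = Σ_s (−1)^s 3^{j−s} C(x,s) C(n−x,j−s)`, the QUATERNARY Krawtchouk polynomial — the tree's
`Coding.krawtchouk` is the binary one; `P_0 = 1`, `P_j(0,n) = 3^j C(n,j)` and the orthogonality relations come with
the proofs file); Rains's system `rainsDual`/`rainsShadow`/`RainsLPFeasible(Pure)`;
CRSS's system `crssDual`/`CRSSLPFeasible`. Named facts: `Rains1999_LPBound` (Thm. 10), `Rains1999_LPBound_pure`
(Remark after Thm. 10), `Rains1999_shadowDistanceBound` (Thm. 15), `Rains1999_quantumSingleton` (Nonbinary codes,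
Thm. 2, `α = 2`); `CRSS1998_theorem21_LP` (LP bound for additive codes, constraints (16)–(21));
`Rains1998_theorem9_shadowBound` (`k ≥ 1`), `Rains1998_theorem6_selfDual` (`k = 0`),
`Rains1999_quantumSingleton_additive` (`k + 2d ≤ n + 2` for `k ≥ 1`). The quantum Hamming bound for pure codes and
the pure Singleton bound are `quantumHammingBound` (PROVED there) and `CRSS1998_theorem23` of `SymplecticCodes.lean`
— not restated.

Deliberately NOT here: the operator-level Shor–Laflamme/Rains enumerators `A_d(M,N)`, `B_d(M,N)`, `S_d(M,N)` and
their MacWilliams/shadow transforms (Thms. 1–8 of [Rains1999Shadow]) — they ARE the proof of Thm. 10 and land with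
it when proofs open (the classical engine exists: `Literature/InformationTheory/Coding/{MacWilliamsIdentity,
KrawtchoukOrthogonality, DelsarteLPBound}.lean`); nonbinary alphabets `α > 2`; LP OPTIMAL VALUES for specific
`(n,k)` — those are certificates (exact rational LP with a dual/Farkas vector), produced by the search seats and
checked against the systems typed here, never asserted. ℕ-subtraction conventions: `n − x`, `j − s` in `krawtchouk4`
(only `x ≤ n`, `s ≤ j` are ever used, as in the tree's binary `krawtchouk`), `n − k` in `crssDual`/`CRSSLPFeasible`
(`k ≤ n` for every additive code: `dim S̄ + k = n`).

References (all read via `lit`; locators in the per-decl docstrings): E. M. Rains, *Quantum shadow enumerators*,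
IEEE Trans. Inform. Theory 45 (1999) 2361–2366 = arXiv:quant-ph/9611001 [Rains1999Shadow]; E. M. Rains, *Shadow
bounds for self-dual codes*, IEEE Trans. Inform. Theory 44 (1998) 134–139 [Rains1998Shadow]; E. M. Rains,
*Nonbinary quantum codes*, IEEE Trans. Inform. Theory 45 (1999) 1827–1832 = arXiv:quant-ph/9703048
[Rains1999Nonbinary]; A. R. Calderbank, E. M. Rains, P. W. Shor, N. J. A. Sloane, *Quantum error correction via
codes over GF(4)*, IEEE Trans. Inform. Theory 44 (1998) 1369–1387 = arXiv:quant-ph/9608006 [CalderbankEtAl1998];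
E. Knill, R. Laflamme, Phys. Rev. A 55 (1997) 900 = arXiv:quant-ph/9604034 [KnillLaflamme1997]. Custody of the
locators: qec-lit-4, `run/shared/lean/pub/qec/lit/LIT-4-REGISTER.md` §B.
-/

namespace Literature.InformationTheory.QuantumCodes

open Finset Matrix
open Literature.Computability.QuantumComplexity

/-! ### General codes carried by their projection -/

section General

variable {ι : Type*} [Fintype ι] [DecidableEq ι]

/-- The (Hamming) **weight** `wt(E)` of a Pauli word `E = σ_1 ⊗ ⋯ ⊗ σ_n`: «the number of the `σ_i` not equal to
the identity». (NOT the Fourier weight `pauliWeight` of `PauliExpansion.lean`.) Column: definition.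
[cite: Rains1999Shadow, §1 p. 2361 (definition of wt(E))] -/
def pauliWt (S : ι → Pauli) : ℕ := #{i | S i ≠ Pauli.I}

/-- **Detection of every Pauli error of weight `≤ t`** by the code with orthogonal projection `P`: for every Pauli
word `E` with `wt(E) ≤ t` there is a scalar `c_E` with `P E P = c_E • P` — the projector form of «`⟨v|E|v⟩ =
⟨w|E|w⟩` for `v, w` ranging over all unit vectors in `𝒞`», restricted (as the source says suffices) to tensor
products of Pauli matrices. Column: definition.
[cite: Rains1999Shadow, §1 p. 2361 (definition of minimum distance)] -/
def DetectsWeightLE (P : Matrix (ι → Bool) (ι → Bool) ℂ) (t : ℕ) : Prop :=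
  ∀ S : ι → Pauli, pauliWt S ≤ t → ∃ c : ℂ, P * pauliString S * P = c • P

/-- **`P` is the orthogonal projection onto an `((n,K,d))` quantum code**, `n = |ι|`, minimum distance AT LEAST `d`:
`P` is Hermitian and idempotent, `Tr P = K` (`= dim 𝒞`), and `P` detects every Pauli error of weight `≤ d − 1`.
Rains's convention that a `((n,1,d))` be pure is not included (see `IsPureToWeight`); `d = 0` reads as `d = 1`.
Column: definition. [cite: Rains1999Shadow, §1 and Thm. 2 p. 2361 («Let P be the orthogonal projection onto a ((n,K,d))»)] -/
def IsCodeProjection (P : Matrix (ι → Bool) (ι → Bool) ℂ) (K d : ℕ) : Prop :=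
  P.IsHermitian ∧ P * P = P ∧ P.trace = (K : ℂ) ∧ DetectsWeightLE P (d - 1)

/-- **Purity to weight `d`**: every Pauli error `E` with `0 < wt(E) < d` satisfies `Tr(E P) = 0` («a pure code is
one in which all low weight errors act nontrivially on the codewords»; in the LP this is `A_i = 0` for
`1 ≤ i < d`). Column: definition. [cite: Rains1999Shadow, §1 p. 2361 (pure/impure) and Remark after Thm. 10 p. 2364] -/
def IsPureToWeight (P : Matrix (ι → Bool) (ι → Bool) ℂ) (d : ℕ) : Prop :=
  ∀ S : ι → Pauli, 0 < pauliWt S → pauliWt S < d → (pauliString S * P).trace = 0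

end General

/-! ### Quaternary Krawtchouk polynomials; the linear systems -/

/-- The **quaternary Krawtchouk polynomial** `P_j(x,n) = Σ_{s=0}^{j} (−1)^s 3^{j−s} C(x,s) C(n−x,j−s)` («the
appropriate Krawtchouk polynomials» for codes of length `n` over `GF(4)` / `n` qubits). Integer-valued; `n − x`,
`j − s` truncated (used only for `x ≤ n`, `s ≤ j`). Column: definition.
[cite: Rains1999Shadow, Thm. 10 p. 2364 (definition of P_i(x,n)); CalderbankEtAl1998 §7 before Thm. 21] -/
def krawtchouk4 (n j x : ℕ) : ℤ :=
  ∑ s ∈ range (j + 1), (-1 : ℤ) ^ s * 3 ^ (j - s) * (x.choose s : ℤ) * ((n - x).choose (j - s) : ℤ)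

/-- Rains's **dual enumerator** `B_j = 2^{−n} Σ_{r=0}^{n} P_j(r,n) A_r`. Column: definition.
[cite: Rains1999Shadow, Thm. 10 p. 2364 (third line of the system)] -/
noncomputable def rainsDual (n : ℕ) (A : ℕ → ℝ) (j : ℕ) : ℝ :=
  (1 / 2 ^ n) * ∑ r ∈ range (n + 1), (krawtchouk4 n j r : ℝ) * A r

/-- Rains's **shadow enumerator** `S_j = 2^{−n} Σ_{r=0}^{n} (−1)^r P_j(r,n) A_r`. Column: definition.
[cite: Rains1999Shadow, Thm. 10 p. 2364 (sixth line of the system)] -/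
noncomputable def rainsShadow (n : ℕ) (A : ℕ → ℝ) (j : ℕ) : ℝ :=
  (1 / 2 ^ n) * ∑ r ∈ range (n + 1), (-1 : ℝ) ^ r * (krawtchouk4 n j r : ℝ) * A r

/-- **Rains's linear system for `((n,K,d))` is feasible**: there are reals `A_0, …, A_n` with `A_0 = K²`;
`A_i ≥ 0` (`0 ≤ i ≤ n`); `A_i = K B_i` (`0 ≤ i < d`); `A_i ≤ K B_i` (`d ≤ i ≤ n`); `S_i ≥ 0` (`0 ≤ i ≤ n`), where
`B_i = rainsDual n A i`, `S_i = rainsShadow n A i`. Column: definition.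
[cite: Rains1999Shadow, Thm. 10 p. 2364 (the system)] -/
def RainsLPFeasible (n K d : ℕ) : Prop :=
  ∃ A : ℕ → ℝ,
    A 0 = (K : ℝ) ^ 2 ∧
    (∀ i, i ≤ n → 0 ≤ A i) ∧
    (∀ i, i < d → A i = K * rainsDual n A i) ∧
    (∀ i, d ≤ i → i ≤ n → A i ≤ K * rainsDual n A i) ∧
    (∀ i, i ≤ n → 0 ≤ rainsShadow n A i)

/-- Rains's system **with the purity constraints** `A_i = 0`, `1 ≤ i < d` («For pure codes, the additional
constraint that `A_i = 0` for `1 ≤ i < d` must hold»). Column: definition.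
[cite: Rains1999Shadow, Remark after Thm. 10 p. 2364] -/
def RainsLPFeasiblePure (n K d : ℕ) : Prop :=
  ∃ A : ℕ → ℝ,
    A 0 = (K : ℝ) ^ 2 ∧
    (∀ i, i ≤ n → 0 ≤ A i) ∧
    (∀ i, 1 ≤ i → i < d → A i = 0) ∧
    (∀ i, i < d → A i = K * rainsDual n A i) ∧
    (∀ i, d ≤ i → i ≤ n → A i ≤ K * rainsDual n A i) ∧
    (∀ i, i ≤ n → 0 ≤ rainsShadow n A i)

/-- CRSS's **dual weight distribution** `A′_j = 2^{−(n−k)} Σ_{r=0}^{n} P_j(r,n) A_r` of the `(n, 2^{n−k})`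
additive code (MacWilliams transform, their Thm. 5). `n − k` truncated (`k ≤ n` in every use). Column: definition.
[cite: CalderbankEtAl1998, §7 Thm. 21 eq. (18)] -/
noncomputable def crssDual (n k : ℕ) (A : ℕ → ℝ) (j : ℕ) : ℝ :=
  (1 / 2 ^ (n - k)) * ∑ r ∈ range (n + 1), (krawtchouk4 n j r : ℝ) * A r

/-- **CRSS's linear system (16)–(21) for an `[[n,k,d]]` additive code is feasible**: there are reals `A_0, …, A_n`
with (16) `A_0 = 1`, `A_1 = 0`, `A_j ≥ 0` (`2 ≤ j ≤ n`); (17) `A_0 + ⋯ + A_n = 2^{n−k}`; (18) `A′_j = crssDual n k A j`;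
(19) `A_j = A′_j` (`0 ≤ j ≤ d−1`), `A_j ≤ A′_j` (`d ≤ j ≤ n`); (20) `Σ_{j} A_{2j} = 2^{n−k−1}` or `2^{n−k}`;
(21) `2^{−(n−k−1)} Σ_r P_j(2r,n) A_{2r} ≥ A′_j` (`0 ≤ j ≤ n`) — (20)–(21) written multiplied by `2`:
`2 Σ_j A_{2j} ∈ {2^{n−k}, 2·2^{n−k}}`, `2 Σ_r P_j(2r,n) A_{2r} ≥ 2^{n−k} A′_j` (no exponent `n−k−1`). Here `A_j`
is the number of vectors of weight `j` in the associated code `C` and `A′_j` that of `C⊥`. Column: definition.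
[cite: CalderbankEtAl1998, §7 Thm. 21 eqs. (16)–(21)] -/
def CRSSLPFeasible (n k d : ℕ) : Prop :=
  ∃ A : ℕ → ℝ,
    A 0 = 1 ∧ A 1 = 0 ∧ (∀ j, j ≤ n → 0 ≤ A j) ∧
    ∑ j ∈ range (n + 1), A j = 2 ^ (n - k) ∧
    (∀ j, j + 1 ≤ d → A j = crssDual n k A j) ∧
    (∀ j, d ≤ j → j ≤ n → A j ≤ crssDual n k A j) ∧
    (2 * ∑ j ∈ (range (n + 1)).filter Even, A j = 2 ^ (n - k) ∨
      ∑ j ∈ (range (n + 1)).filter Even, A j = 2 ^ (n - k)) ∧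
    (∀ j, j ≤ n →
      2 ^ (n - k) * crssDual n k A j ≤ 2 * ∑ r ∈ (range (n + 1)).filter Even, (krawtchouk4 n j r : ℝ) * A r)

/-! ### Named facts — general codes `((n,K,d))` -/

/-- **Rains's linear-programming bound for general QECCs (with the shadow inequalities).** «Theorem 10 (LP bound for
general QECCs). If a `((n,K,d))` exists, then there is a solution to the following set of linear equations and
inequalities: `A_0 = K²`; `A_i ≥ 0` (`0 ≤ i ≤ n`); `B_i = 2^{−n} Σ_{0≤r≤n} P_i(r,n) A_r`; `A_i = K B_i`
(`0 ≤ i < d`); `A_i ≤ K B_i` (`d ≤ i ≤ n`); `S_i = 2^{−n} Σ_{0≤r≤n} (−1)^r P_i(r,n) A_r`; `S_i ≥ 0` (`0 ≤ i ≤ n`),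
where `P_i(x,n) = Σ_{0≤s≤i} (−1)^s 3^{i−s} C(x,s) C(n−x,i−s)`.» (The solution in the proof is
`A_i = Σ_{wt E = i} Tr(EP)²`.) Stated for codes carried by their projection on `n` labelled qubits. Named fact, not
proved here (its proof is Thms. 1–8 of the source: quantum MacWilliams identities + shadow positivity). Column:
cited fact.

BARRIER
technique_class: code-parameters, linear-programming-bound, weight-enumerators, shadow-enumerator, all-quantum-codes
blocks: any claim «an `((n,K,d))` (in particular an `[[n,k,d]]` with `K = 2^k`) exists» for which this system is INFEASIBLE; this is the sense in which a census row may be called LP-optimal for `(n,k)`: infeasibility at `d+1`, exhibited by an exact (rational) dual/Farkas certificate checked against `RainsLPFeasible` [cite: Rains1999Shadow, Thm. 10 and the table discussion after it p. 2364].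
because: the Shor–Laflamme enumerators of `P` satisfy the quantum MacWilliams identity `B(x,y) = A((x+3y)/2,(x−y)/2)`, `A_0 = K²`, `K B_i − A_i ≥ 0` with equality below `d`, and the shadow enumerator `S(x,y) = A((x+3y)/2,(y−x)/2)` has nonnegative coefficients [cite: Rains1999Shadow, Thms. 1, 2, 8 and Cor. 7].
evasions_known: none inside quantum coding theory — the bound constrains existence, not constructions; it is NOT tight in general (feasible systems with no code, e.g. the ten entries where the general-code bound exceeds the additive one by exactly 1) [cite: Rains1999Shadow, §3 (table after Thm. 10) p. 2364]; subsystem codes and entanglement-assisted codes are outside its hypotheses (different objects).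
scope_caveats: qubit codes only (`α = 2`); real feasibility is necessary, not sufficient, for existence; floating-point LP solutions «cannot be trusted» near `n ≈ 30` — use exact arithmetic [cite: CalderbankEtAl1998, §7 (discussion after Thm. 22)]; for `K = 1` the detection hypothesis is vacuous and the system is trivially feasible unless purity is added (`Rains1999_LPBound_pure`).
status: published theorem; named fact (unproved in the tree). [cite: Rains1999Shadow, Thm. 10 p. 2364] -/
def Rains1999_LPBound : Prop :=
  ∀ (n K d : ℕ) (P : Matrix (Fin n → Bool) (Fin n → Bool) ℂ),
    IsCodeProjection P K d → RainsLPFeasible n K d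

/-- **Rains's LP bound, pure codes.** For a PURE `((n,K,d))` (every Pauli error with `1 ≤ wt < d` has `Tr(EP) = 0`)
the system of Thm. 10 is solvable together with `A_i = 0` for `1 ≤ i < d` («Remark. For pure codes, the additional
constraint that `A_i = 0` for `1 ≤ i < d` must hold»). Column: cited fact.

BARRIER
technique_class: code-parameters, linear-programming-bound, pure-codes
blocks: existence claims for PURE (nondegenerate) `((n,K,d))` with this strengthened system infeasible [cite: Rains1999Shadow, Remark after Thm. 10 p. 2364].
because: purity means `A_i(P) = Σ_{wt E = i} Tr(EP)² = 0` for `1 ≤ i < d` [cite: Rains1999Shadow, §1 and Remark after Thm. 10].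
evasions_known: impure (degenerate) codes are not subject to the extra constraints — «the LP bound for impure codes agrees with the LP bound for pure codes for all `n` checked (`1 ≤ n ≤ 30`)» is an observation, not a theorem [cite: Rains1999Shadow, §3 p. 2364].
scope_caveats: as `Rains1999_LPBound`.
status: published; named fact (unproved in the tree). [cite: Rains1999Shadow, Thm. 10 with the Remark after it, p. 2364] -/
def Rains1999_LPBound_pure : Prop :=
  ∀ (n K d : ℕ) (P : Matrix (Fin n → Bool) (Fin n → Bool) ℂ),
    IsCodeProjection P K d → IsPureToWeight P d → RainsLPFeasiblePure n K d

/-- **Rains's shadow bound on the minimum distance of an arbitrary quantum code.** «Theorem 15. If a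
`((6m−1+l, K, d))` exists for `K > 1`, with `0 ≤ l ≤ 5`, then `d ≤ 2m+1` (`l < 5`), `d ≤ 2m+2` (`l = 5`). …
In particular, any quantum code of length `n` can correct at most `⌊(n+1)/6⌋` errors.» With `n = 6m−1+l`:
`m = ⌊(n+1)/6⌋`, `l = (n+1) mod 6`, and `l = 5 ⇔ n ≡ 4 (mod 6)`; so: `d ≤ 2⌊(n+1)/6⌋ + 1`, except
`d ≤ 2⌊(n+1)/6⌋ + 2` when `n ≡ 4 (mod 6)`. The clause «any `((6m−1,K,2m+1))` is the even subcode of a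
`((6m−1,1,2m+1))`» is not restated. The source obtains it «from» [Rains1998Shadow], where the proof is printed for
additive codes (Thm. 9 there, typed below as `Rains1998_theorem9_shadowBound`) and, as noted at Thm. 14, «makes no
assumptions of integrality, so carries over directly». Column: cited fact.

BARRIER
technique_class: code-parameters, shadow-enumerator, linear-programming-bound, all-quantum-codes, distance-vs-length
blocks: any `((n,K,d))`, `K > 1` — in particular any `[[n,k,d]]`, `k ≥ 1` — with `d > 2⌊(n+1)/6⌋ + 1` (`+2` if `n ≡ 4 mod 6`); equivalently «a length-`n` code corrects at most `⌊(n+1)/6⌋` errors» [cite: Rains1999Shadow, Thm. 15 p. 2365].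
because: a fixed positive combination of the first `d` coefficients of `Δ(1,y) = A(1,y) − A((1+3y)/2,(1−y)/2)` is a negative combination of shadow coefficients, contradicting their signs (Bürmann–Lagrange coefficient computation) [cite: Rains1998Shadow, §V Thms. 7–9].
evasions_known: none (a theorem about all codes); the bound is met by several short codes (`[[5,1,3]]`, `[[10,2,4]]`, `[[11,1,5]]`, `[[16,1,6]]`, `[[17,1,7]]` are exact entries of CRSS Table III attaining it; transcription qec-lit-1, `lit/tables/CRSS1998-TableIII.tsv`) while for most `(n,k)` the LP bound is the stronger one («All unmarked upper bounds in the table come from the linear programming bound of Theorem 21») [cite: CalderbankEtAl1998, §8 (Notes on Table III)].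
scope_caveats: `K > 1` essential (for `K = 1` the pure self-dual bound is `2m+2`/`2m+3`, Thm. 14, not restated here); qubits only.
status: published theorem (proof in the 1998 companion paper); named fact (unproved in the tree). [cite: Rains1999Shadow, Thm. 15 p. 2365] -/
def Rains1999_shadowDistanceBound : Prop :=
  ∀ (n K d : ℕ) (P : Matrix (Fin n → Bool) (Fin n → Bool) ℂ),
    1 < K → IsCodeProjection P K d →
      d ≤ 2 * ((n + 1) / 6) + (if n % 6 = 4 then 2 else 1)

/-- **Quantum Singleton bound** (qubit alphabet). «Theorem 2 (Quantum Singleton bound). Let `𝒞` be a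
`((n,K,d))_α` with `K > 1`. Then `K ≤ α^{n−2d+2}`. If equality holds, then `𝒞` is pure to weight `n−d+2`.
Similarly, a pure `((n,1,d))_α` satisfies `2d ≤ n+2`.» Here `α = 2`, exponent in `ℤ` exactly as printed (for
`2d > n+2` the right-hand side is `< 1`: no such code); the purity and `K = 1` clauses are not restated. The source
attributes the `α = 2` bound to earlier work «using an essentially equivalent proof» (Knill–Laflamme: «a `(2^r,k)`
`e`-error-correcting quantum code must satisfy `r ≥ 4e + ⌈log k⌉`», Thm. 5.1 of [KnillLaflamme1997]; CRSS eq. (15)).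
Column: cited fact.
-- TODO(general form): alphabet size α (qudits), [Rains1999Nonbinary, Thm. 2] as printed.

BARRIER
technique_class: code-parameters, singleton-bound, weight-enumerators, all-quantum-codes
blocks: any `((n,K,d))` with `K > 2^{n−2d+2}`; for stabilizer codes any `[[n,k,d]]`, `k ≥ 1`, with `k > n − 2d + 2` (`Rains1999_quantumSingleton_additive`) [cite: Rains1999Nonbinary, Thm. 2 p. 1828].
because: the unitary weight enumerator `A′_{n−d+1}` is simultaneously a nonnegative combination of `B_i`, `i ≤ d−1`, and of `A_i`, `i ≤ n−d+1`; with `B_i = K^{−1}A_i` below `d` the coefficients have incompatible signs once `K ≥ α^{n−2d+2}`, `K > 1` [cite: Rains1999Nonbinary, proof of Thm. 2].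
evasions_known: none for block codes; the PURE qubit codes meeting it are exactly `[[n,n,1]]`, `[[n,n−2,2]]` (`n` even), `[[5,1,3]]`, `[[6,0,4]]`, unique up to equivalence («A pure `[[n, n−2d+2, d]]` code has parameters …», proof omitted in print) [cite: CalderbankEtAl1998, §7 Thm. 24]; larger alphabets have more quantum MDS codes [cite: Rains1999Nonbinary, §«Quantum MDS codes»]; entanglement-assisted / subsystem codes obey different Singleton-type bounds (other objects, not typed here).
scope_caveats: `K > 1` is essential (for `K = 1`, «distance» is the purity weight); impure codes ARE covered.
status: published theorem; named fact (PROVE-wave-1 candidate for stabilizer codes via cleaning/counting, LIT-4-REGISTER §B1). [cite: Rains1999Nonbinary, Thm. 2 p. 1828 (Quantum Singleton bound)] -/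
def Rains1999_quantumSingleton : Prop :=
  ∀ (n K d : ℕ) (P : Matrix (Fin n → Bool) (Fin n → Bool) ℂ),
    1 < K → IsCodeProjection P K d → (K : ℝ) ≤ (2 : ℝ) ^ ((n : ℤ) - 2 * d + 2)

/-! ### Named facts — additive (stabilizer) codes `[[n,k,d]]` -/

/-- **Linear-programming bound for additive quantum codes (CRSS Theorem 21).** «Theorem 21. If an `[[n,k,d]]`
quantum-error-correcting code exists such that the associated `(n, 2^{n−k})` code `C` contains no vectors of weight
`1`, then there is a solution to the following set of linear equations and inequalities: (16) `A_0 = 1`, `A_1 = 0`,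
`A_j ≥ 0` (`2 ≤ j ≤ n`); (17) `A_0 + A_1 + ⋯ + A_n = 2^{n−k}`; (18) `A′_j = 2^{−(n−k)} Σ_{r=0}^{n} P_j(r,n) A_r`
(`0 ≤ j ≤ n`); (19) `A_j = A′_j` (`0 ≤ j ≤ d−1`), `A_j ≤ A′_j` (`d ≤ j ≤ n`); (20) `Σ_{j≥0} A_{2j} = 2^{n−k−1}` or
`2^{n−k}`; (21) `2^{−(n−k−1)} Σ_{r=0}^{n} P_j(2r,n) A_{2r} ≥ A′_j` (`0 ≤ j ≤ n`).» In the tree's language the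
associated code `C` is the self-orthogonal `S̄ ≤ Ē` of `IsAdditiveCode S k d` (GF(4) dictionary, CRSS Thm. 2) and
«no vectors of weight 1» is `sympWeight v ≠ 1` on `S̄`; the hypothesis is harmless in the census («In view of
Theorem 6(e), we may assume that `A_1 = 0`»). Column: cited fact.

BARRIER
technique_class: code-parameters, linear-programming-bound, additive-codes, stabilizer-codes, shadow
blocks: «an `[[n,k,d]]` additive code (without weight-1 stabilizer elements) exists» whenever `CRSSLPFeasible n k d` fails — the source of the UPPER bounds of CRSS Table III («If … no feasible solution exists, … we can conclude that no `[[n,k,d]]` code exists») [cite: CalderbankEtAl1998, §7 Thm. 21 and the implementation notes after Thm. 22].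
because: (18) is the MacWilliams identity for additive codes over `GF(4)` (their Thm. 5), (19) is `C ⊆ C⊥` plus «vectors of `C⊥` of weight `1 … d−1` lie in `C`», (20)–(21) come from the even subcode `C′` (`C′ ⊂ C ⊂ C⊥ ⊂ C′⊥`) — the additive form of the shadow [cite: CalderbankEtAl1998, proof of Thm. 21].
evasions_known: NON-additive codes are not subject to (17), (20), (21) — the general-code system is `Rains1999_LPBound` (in ten table entries the general bound is larger by exactly 1) [cite: Rains1999Shadow, §3 p. 2364]; codes whose stabilizer has a weight-1 element reduce to length `n−1` (CRSS Thm. 6(e)).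
scope_caveats: feasibility is necessary, not sufficient; exact arithmetic required in practice («the results cannot be trusted» in double precision near `n ≈ 30`) [cite: CalderbankEtAl1998, §7 (after Thm. 22)]; `n−k` is truncated subtraction in `crssDual` (always `k ≤ n`).
status: published theorem; named fact (unproved in the tree; the classical binary analogue `Coding.card_le_delsarteBound` is proved). [cite: CalderbankEtAl1998, §7 Thm. 21 (eqs. (16)–(21))] -/
def CRSS1998_theorem21_LP : Prop :=
  ∀ (n k d : ℕ) (S : Submodule (ZMod 2) (SympVec n)),
    IsAdditiveCode S k d → (∀ v ∈ S, sympWeight v ≠ 1) → CRSSLPFeasible n k d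

/-- **Rains's shadow bound for additive codes with `k ≥ 1` (the printed proof).** «Theorem 9: Let `C` be an additive
code over `GF(4)`, of length `n = 6m − 1 + l` with `0 ≤ l ≤ 5`, and dimension `n − r < n`, such that `C⊥ − C` has
minimum weight `d`. Then `d ≤ 2m + 1`, except when `l = 5`, when `d ≤ 2m + 2`. Any code meeting the bound for
`l = 0` must be the even subcode of a `[6m − 1, 6m − 1, 2m + 1]_4`.» Here `C` = the stabilizer space `S̄`
(self-orthogonal, `GF(2)`-dimension `n − k`, so `r = k ≥ 1`) and the bound is written in `n`: `d ≤ 2⌊(n+1)/6⌋ + 1`,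
`+2` instead of `+1` when `n ≡ 4 (mod 6)` (`l = (n+1) mod 6 = 5`). The last clause is not restated. Column: cited fact.

BARRIER
technique_class: code-parameters, shadow-enumerator, additive-codes, stabilizer-codes, distance-vs-length
blocks: any stabilizer `[[n,k,d]]` with `k ≥ 1` and `d > 2⌊(n+1)/6⌋ + 1` (`+2` if `n ≡ 4 mod 6`) — e.g. no `[[12,k≥1,6]]`, no `[[18,k≥1,8]]`; a census «record» can never exceed it [cite: Rains1998Shadow, §V Thm. 9 p. 138].
because: LP duality between `Δ(x,y) = A(x,y) − A((x+3y)/2,(x−y)/2)` and the shadow enumerator `Σ(x,y) = 2^{r−1}Δ((x+3y)/2,(y−x)/2) = ½(S(x,y) − S(−x,y)) ≥ 0`, with explicit Bürmann–Lagrange coefficients of fixed sign [cite: Rains1998Shadow, §V Thms. 7–8 and the proof of Thm. 9].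
evasions_known: none (all additive codes with `k ≥ 1`); `k = 0` (self-dual) codes obey the weaker `Rains1998_theorem6_selfDual` (`[[6,0,4]]`, `[[12,0,6]]` exist); the bound «makes no use of the dimension of the code; for smaller codes, one ought to be able to produce much stronger bounds» [cite: Rains1998Shadow, §VI].
scope_caveats: qubit (GF(4)-additive) codes; monotone reading of `d` (any `d` with no logical of weight `< d`).
status: published theorem with printed proof; named fact (unproved in the tree). [cite: Rains1998Shadow, §V Thm. 9 p. 138] -/
def Rains1998_theorem9_shadowBound : Prop :=
  ∀ n k d : ℕ, 1 ≤ k → AdditiveCodeExists n k d →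
    d ≤ 2 * ((n + 1) / 6) + (if n % 6 = 4 then 2 else 1)

/-- **Rains's shadow bound for self-dual additive codes (`k = 0`).** «Theorem 6: If a self-dual `[6m+l, 6m+l, d]_4`
exists, with `0 ≤ l ≤ 5`, then `d ≤ 2m+2` (`l < 5`), `d ≤ 2m+3` (`l = 5`). If a self-dual `[6m+5, 6m+5, d]_4`
exists, then so does an even self-dual `[6m+6, 6m+6, d]_4`. Finally, any self-dual `[6m+6, 6m+6, d]_4` must be
even.» (Rains's `[n, k, d]_4` has `k` = the `GF(2)`-dimension, so «self-dual `[n,n,d]_4`» is an `[[n,0,d]]`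
stabilizer state with `d` = minimum nonzero weight of `S̄ = S̄⊥`, which is the `k = 0` convention of
`IsAdditiveCode`.) Written in `n`: `d ≤ 2⌊n/6⌋ + 2`, `+3` when `n ≡ 5 (mod 6)`. Only the bound is restated, and
with the explicit hypothesis `1 ≤ n`: for `n = 0` the `k = 0` purity convention of `IsAdditiveCode` is vacuous (the
zero space has no nonzero vector), so `AdditiveCodeExists 0 0 d` holds for every `d` — the printed statement is about
codes of positive length (same boundary as `CRSS1998_theorem23`). Column: cited fact.

BARRIER
technique_class: code-parameters, shadow-enumerator, self-dual-codes, stabilizer-states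
blocks: any `[[n,0,d]]` with `d > 2⌊n/6⌋ + 2` (`+3` if `n ≡ 5 mod 6`) [cite: Rains1998Shadow, §IV Thm. 6 p. 138].
because: Bürmann–Lagrange coefficients `α_{2m+1}(6m−l) < 0`, `β_{(2m+1)j} ≥ 0` force a sign contradiction in the shadow identity for self-dual additive codes over `GF(4)` [cite: Rains1998Shadow, §IV].
evasions_known: none; met by the hexacode `[[6,0,4]]` and the dodecacode `[[12,0,6]]` (entries `a`, `e` of their table) [cite: CalderbankEtAl1998, §8 Table III (n = 6, 12; k = 0)].
scope_caveats: `k = 0` only; `1 ≤ n` explicit (vacuity of the purity convention at `n = 0`); qubits.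
status: published theorem with printed proof; named fact (unproved in the tree). [cite: Rains1998Shadow, §IV Thm. 6 p. 138] -/
def Rains1998_theorem6_selfDual : Prop :=
  ∀ n d : ℕ, 1 ≤ n → AdditiveCodeExists n 0 d →
    d ≤ 2 * (n / 6) + (if n % 6 = 5 then 3 else 2)

/-- **Quantum Singleton bound for stabilizer codes**: an `[[n,k,d]]` additive code with `k ≥ 1` has
`k ≤ n − 2d + 2`, typed as `k + 2d ≤ n + 2`. This is Thm. 2 of the source (`K ≤ α^{n−2d+2}` for `K > 1`, typed
above as `Rains1999_quantumSingleton`) applied through its Thm. 1 («If there exists an `[[n,k,d]]_p`, then there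
exists a `((n,p^k,d))_p`») with `p = α = 2`, `K = 2^k > 1`; CRSS quote the Knill–Laflamme form «any (pure or
impure) code must satisfy `n ≥ 4e + k`, `e = ⌊(d−1)/2⌋`» (eq. (15)) and prove the pure case (Thm. 23,
`CRSS1998_theorem23` of `SymplecticCodes.lean`). Column: cited fact.

BARRIER
technique_class: code-parameters, singleton-bound, additive-codes, stabilizer-codes
blocks: any stabilizer `[[n,k,d]]`, `k ≥ 1`, with `k + 2d > n + 2` (e.g. no `[[4,2,3]]`, no `[[n,1,d]]` with `2d > n+1`) [cite: Rains1999Nonbinary, Thm. 2 with Thm. 1].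
because: see `Rains1999_quantumSingleton`; for stabilizer codes also provable by cleaning: two disjoint sets of `d−1` qubits are each correctable, so the remaining `n − 2(d−1)` qubits carry all `k` logical qubits (standard cleaning argument; cf. CRSS eq. (15)).
evasions_known: none for block stabilizer codes; impure codes ARE covered (unlike `CRSS1998_theorem23`).
scope_caveats: `k ≥ 1` essential (`k = 0`: `d` is the purity weight, bounded instead by `2d ≤ n + 2` for pure `((n,1,d))`).
status: published theorem; named fact; PROVE-wave-1 candidate (LIT-4-REGISTER §B1: est. ≤ 150 lines over `SymplecticCodes.lean`). [cite: Rains1999Nonbinary, Thm. 2 with Thm. 1 (α = p = 2), p. 1828] -/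
def Rains1999_quantumSingleton_additive : Prop :=
  ∀ n k d : ℕ, 1 ≤ k → AdditiveCodeExists n k d → k + 2 * d ≤ n + 2

/-- **Discharge of `Rains1999_quantumSingleton_additive`** by the tree's proof of the quantum Singleton
bound for binary stabilizer codes (`quantumSingleton_additive`, file `QuantumSingletonBound.lean`: cleaning
dimension count). [cite: Rains1999Nonbinary, Thm. 2 with Thm. 1 (α = p = 2), p. 1828] -/
theorem Rains1999_quantumSingleton_additive_holds : Rains1999_quantumSingleton_additive :=
  fun _n _k _d hk h => h.quantumSingleton hk

end Literature.InformationTheory.QuantumCodes
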